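import Mathlib
import HarnessLib
import Summits.Langlands.Langlands.Theses.SkinnerWilesDefectOne
import Summits.Langlands.Langlands.Theorems.ReducibleOrdinaryProModular.Negative.LevelAndRamification
import Literature.NumberTheory.GaloisRepresentations.NearlyOrdinaryDeformationRing
import Summits.Langlands.Langlands.Theorems.SkinnerWilesDefectOneReducibleOrdinaryProModularDefs
import Summits.Langlands.Langlands.Theorems.SkinnerWilesDefectOneReducibleOrdinaryProModularOrientedLocalDatum
import Summits.Langlands.Langlands.Theorems.SkinnerWilesDefectOneReducibleOrdinaryProModularIharaCrossingDivisorAux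

/-! # The Skinner–Wiles / Calegari–Mazur set-up at the point of `ρ`: stub `stub_typeDSetup` of line
generic-eisenstein-rigidity (crux ReducibleOrdinaryProModular, stmt-Langlands-12919)

From the crux data VERBATIM — `F` imaginary quadratic, `p` odd, `O` the valuation ring of `ℚ̄_p`,
`ρ : Γ_F → GL₂(ℚ̄_p)` continuous, irreducible, almost everywhere unramified, with an integral model `ρ₀` over `O`
that is upper triangular modulo `𝔪_O`, `p`-distinguished and Skinner–Wiles ORIENTED ordinary at every `v ∣ p`
(the crux's local clause, definitionally `SteinbergHyperplane.OrdLoc`) — we produce the set-up of Skinner–Wiles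
§2.1 / Calegari–Mazur §2 at the point of `ρ`: a coefficient ring `𝒪` (a complete DVR of characteristic `0` with
finite residue field `k` of characteristic `p`), an SW-admissible ORIENTED residual datum `𝒟` over `(𝒪, k)`
(scalar centralizer, `p`-distinguished, residually upper triangular, special line transverse to the global
sub-line: `(𝒟.frame v)₁₀ ≠ 0`), a universal nearly ordinary deformation ring `𝓡 = R_𝒟`, and a LOCAL INTEGRAL
specialisation `f : R_𝒟 → ℚ̄_p` (`‖f r‖ ≤ 1`, `‖f r‖ < 1` on `𝔪_R`) whose kernel `𝔭` is a prime OUTSIDE the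
reducible locus and with `ρ = P · (f ∘ ρ_𝒟) · P⁻¹`.

Everything is assembled from the sibling line `steinberg-hyperplane`'s landed pieces: the oriented local model
`SteinbergHyperplane.stub_orientedLocalDatum` (any auxiliary place `v₀`; we take an arbitrary maximal ideal of
`𝓞 F`), whose `ModelData.Models` / `ModelData.IsLocalPoint` fields are exactly the [SW] conjuncts and the two
valuation inequalities, and `SteinbergHyperplane.ModelData.Models.ker_notMem_reducibleLocus` (the point of an
irreducible `ρ` is not in the reducible locus).

References: Skinner–Wiles, Publ. Math. IHÉS 89 (1999), §2.1; Calegari–Mazur, J. Inst. Math. Jussieu 8 (2009),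
§2.1–2.2.
-/

set_option linter.dupNamespace false
namespace Summit.Langlands.Langlands.Cruxes.ReducibleOrdinaryProModular.GenericEisensteinRigidity
open Summit.Langlands.Langlands.Theses.SkinnerWilesDefectOne
open Literature.NumberTheory.Automorphic Literature.NumberTheory.Automorphic.BigHeckeGLn
open Literature.NumberTheory.GaloisRepresentations
open NumberField IsDedekindDomain IsLocalRing Filter Field
open scoped MatrixGroups Matrix NumberField NNReal
noncomputable section

/-- **stub_typeDSetup (Skinner–Wiles / Calegari–Mazur set-up).**  For every admissible datum of the crux
(hypotheses VERBATIM) there are a coefficient ring `𝒪` (complete Noetherian local domain of characteristic `0`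
with finite residue field `k` of characteristic `p`), an SW-admissible ORIENTED residual datum `𝒟`, a universal
nearly ordinary deformation ring `𝓡 = R_𝒟`, and an integral (`‖f r‖ ≤ 1`) and local (`‖f r‖ < 1` on `𝔪_R`)
specialisation `f : R_𝒟 → ℚ̄_p` whose kernel `𝔭` is a prime OUTSIDE the reducible locus (`ρ` is irreducible)
and such that `ρ` is `GL₂(ℚ̄_p)`-conjugate to `f ∘ ρ_𝒟`.  Proof: the oriented local model of
`SteinbergHyperplane.stub_orientedLocalDatum` at an arbitrary auxiliary place, read through
`ModelData.Models`, `ModelData.IsLocalPoint` and `ModelData.Models.ker_notMem_reducibleLocus`.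
[cite: SkinnerWiles1999, §2.1] [cite: CalegariMazur2008, §2.1–2.2] -/
theorem stub_typeDSetup : ∀ (F : Type) [Field F] [NumberField F], IsTotallyComplex F →
    Module.finrank ℚ F = 2 → ∀ (p : ℕ) [Fact p.Prime], p ≠ 2 →
    ∀ (O : ValuationSubring (PadicAlgCl p)),
    O = (Valued.v : Valuation (PadicAlgCl p) NNReal).valuationSubring →
    ∀ (ρ : FramedGaloisRep F (PadicAlgCl p) 2) (ρ₀ : absoluteGaloisGroup F →* GL (Fin 2) O),
    ρ.toGaloisRep.IsIrreducible → (∀ᶠ v in cofinite, ρ.IsUnramifiedAt v) →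
    ρ.HasUpperTriangularIntegralModel ρ₀ →
    (∃ k : ℕ, 2 ≤ k ∧ ∃ m : ℕ, 0 < m ∧ ∀ v : HeightOneSpectrum (𝓞 F), (p : 𝓞 F) ∈ v.asIdeal →
      IsPDistinguishedAt ρ₀ v ∧ ∃ Q : GL (Fin 2) (PadicAlgCl p),
        Valued.v (Q.val 0 0) ≤ Valued.v (Q.val 1 0) ∧ ∀ σ, (Q⁻¹ * ρ.toLocal v σ * Q).val 1 0 = 0 ∧
        (σ ∈ absInertia (v.adicCompletion F) → (Q⁻¹ * ρ.toLocal v σ * Q).val 1 1 ^ m = 1 ∧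
          (Q⁻¹ * ρ.toLocal v σ * Q).val 0 0 ^ m = algebraMap ℚ_[p] (PadicAlgCl p)
            (((GaloisRep.cyclotomicCharacter (v.adicCompletion F) p σ).val : ℤ_[p]) : ℚ_[p]) ^
              ((k - 1) * m))) →
    ∃ (𝒪 : Type) (_ : CommRing 𝒪) (_ : IsLocalRing 𝒪) (_ : IsNoetherianRing 𝒪)
      (_ : IsAdicComplete (maximalIdeal 𝒪) 𝒪) (k : Type) (_ : Field k) (_ : Finite k) (_ : CharP k p)
      (_ : Algebra 𝒪 k) (𝒟 : NearlyOrdinaryDatum F p 𝒪 k) (𝓡 : NearlyOrdinaryDeformationRing.{0} 𝒟)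
      (𝔭 : PrimeSpectrum 𝓡.R) (f : 𝓡.R →+* PadicAlgCl p) (P : GL (Fin 2) (PadicAlgCl p)),
      (IsTotallyComplex F ∧ Module.finrank ℚ F = 2 ∧ p ≠ 2 ∧ IsDomain 𝒪 ∧ CharZero 𝒪 ∧
      𝒟.HasScalarCentralizer ∧
      (∀ v : HeightOneSpectrum (𝓞 F), (p : 𝓞 F) ∈ v.asIdeal → 𝒟.IsDistinguishedAt v) ∧
      (∀ γ, (𝒟.residual γ).val 1 0 = 0) ∧
      (∀ v : HeightOneSpectrum (𝓞 F), (p : 𝓞 F) ∈ v.asIdeal → (𝒟.frame v).val 1 0 ≠ 0)) ∧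
      RingHom.ker f = 𝔭.asIdeal ∧ 𝔭 ∉ 𝓡.reducibleLocus ∧
        (∀ r, Valued.v (f r) ≤ 1) ∧ (∀ r ∈ maximalIdeal 𝓡.R, Valued.v (f r) < 1) ∧
        (∀ γ, ρ γ = P * Matrix.GeneralLinearGroup.map f (𝓡.ρ γ) * P⁻¹) := by
  intro F _ _ hF hdeg p _ hp O hO ρ ρ₀ hirr hunr hint hloc
  -- an arbitrary auxiliary finite place `v₀` (any maximal ideal of `𝓞 F`, which is not a field)
  obtain ⟨M₀, hM₀⟩ := Ideal.exists_maximal (𝓞 F)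
  obtain ⟨M, hM, hMloc⟩ := SteinbergHyperplane.stub_orientedLocalDatum F hF hdeg p hp O hO ρ ρ₀ hirr hunr
    hint hloc ⟨M₀, hM₀.isPrime, Ring.ne_bot_of_isMaximal_of_not_isField hM₀ (RingOfIntegers.not_isField F)⟩
  obtain ⟨hMint, hMlocf⟩ := hMloc
  obtain ⟨P, hP⟩ := hM.realizes
  refine ⟨M.𝒪, inferInstance, inferInstance, inferInstance, inferInstance, M.k, inferInstance, inferInstance,
    inferInstance, inferInstance, M.𝒟, M.𝓡, ⟨RingHom.ker M.φ, RingHom.ker_isPrime M.φ⟩, M.φ, P,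
    ⟨hF, hdeg, hp, inferInstance, inferInstance, hM.hasScalarCentralizer, hM.isDistinguishedAt,
      hM.residual_upper, hM.oriented⟩,
    rfl, hM.ker_notMem_reducibleLocus hirr, hMint, hMlocf, fun γ => ?_⟩
  rw [hP γ]
  group

end

end Summit.Langlands.Langlands.Cruxes.ReducibleOrdinaryProModular.GenericEisensteinRigidity
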